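import Mathlib
import HarnessLib
import Summits.HubbardSuperconductivity.HubbardSuperconductivity.Theorems.KLProgrammeKLRegimeOverlapWtJumpFlowAll
import Summits.HubbardSuperconductivity.HubbardSuperconductivity.Theorems.KLProgrammeKLRegimeOverlapWtColFlowDeep

/-!
# K3 / VL (stmt-HubbardSuperconductivity-23356 `KLRegimeVolumeLimitV17F3`), brick B1 «(VL)-SRC-COLS» (pen (R283); VL lead k3c4-p1 g19's SRC-SOFT chain):
# the FULL weighted COLUMN sums of the GENERAL JUMP `E(klAnisoFamily J′[K_n])·S(F̃_k[K_n])` AT THE FLOW FRAME WITH NO DEPTH WINDOW — every `k + 1 ≤ J′ ≤ n`,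
# any weaker rate `jw ≥ J′` (cell gate-hubbard-kl, seat hubbard-kl-p1 g23; twin of p4 g17's `overlapWt_jump_sums_klEng_flow_all` for the column constant `cc`)

p3's `overlapWt_colSum_klEng_flow_deep(_rate) (d′)` (…OverlapWtColFlowDeep) gives the full weighted column sums `Σ_{X″}‖(E S)(X″,X′)‖·w ≤ 81·2^{J′−k}·C_J·M/β` under
the deep window `4ⁿ·U ≤ 4^{2(k+1)+d′}`; its kernel-level assembly `overlapWt_colSum_le_of_nbWindow` only needs, at every level `m ∈ [k+1, J′]`, the neighbouring thin × thin
weighted character sum at the rate `Λ_{J′} ≤ Λ_m`.  p4's `charSumWt_nbPair_klEng_flow_all (R) (c″)` (…OverlapWtJumpFlowAll) supplies each level's OWN-rate sum with NO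
window (deep levels by p3's datum route at `K_n`, coarse levels by the mean-free character-sum telescope under the REGISTERED (K5′) clauses
`∀ m, 1 ≤ m → m < n → FlowPieceOscAt … c″ … m`).  This file is the composition:
* **`overlapWt_colSum_klEng_flow_all (R) (c″)`** — `∃ C_J > 0`: p4's binder list (stub binders + `c″U ≤ 1`, `1 ≤ n ≤ n_β + 1`, `IsKLRegime U cc (−n)`, `HistP … 0 n`,
  the (K5′) clauses), for EVERY `k + 1 ≤ J′ ≤ n`, every rate `jw ≥ J′` and every fat leg `X′`:
  `Σ_{X″} ‖(E(F_{J′}[K_n])·S(F̃_k[K_n]))(X″, X′)‖·klScaleWt jw {pos X″, pos X′} ≤ 81·2^{J′−k}·C_J·M/β` — the window-free twin of `overlapWt_colSum_klEng_flow_deep_rate`;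
* **`overlapWt_towerBlockCol_klEng_flow_all (d) (R) (c″)`** — the tower's indexing (fat `d·k − 1`, thin `J′ ≥ d·k`, weight `jw ≥ J′`): `cc := 81·2^{J′−(dk−1)}·C_J·M/β`,
  the window-free twin of `overlapWt_towerBlockCol_klEng_flow_deep` (k3c3-p2's `overlapWt_towerBlock_klEng_flow_all` is the case `J′ = dk`).
The constant depends on `(R, c″)` only.  Everything is proved; no definitions; nothing about the model is asserted beyond the landed theorems; nothing asserts any stub, VL,
K3 or superconductivity. [cite: BenfattoGiulianiMastropietro2006, §2.7 (2.71a), §2.8 (2.77), (2.82)–(2.83), §3 (3.2)–(3.8)]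
-/

noncomputable section

namespace Summit.HubbardSuperconductivity.HubbardSuperconductivity.Theorems.TorusFourierL2

set_option linter.dupNamespace false -- summit = problem name (single-conjunct summit), D-0017

open Set Finset Literature.MathematicalPhysics.QuantumLattice Literature.MathematicalPhysics.QuantumLattice.BandSectorCounting
open Literature.MathematicalPhysics.QuantumLattice.FermiRG Literature.Probability.LatticeModels Literature.Analysis.SpecialFunctions
open Summit.HubbardSuperconductivity.HubbardSuperconductivity.Theorems.DispersionFlow
open Summit.HubbardSuperconductivity.HubbardSuperconductivity.Theorems.KLRegimeSplit
open Summit.HubbardSuperconductivity.HubbardSuperconductivity.Theorems.KLProgrammeLegKernels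
open Summit.HubbardSuperconductivity.HubbardSuperconductivity.Theorems.PerturbedFermiCurve
open scoped Real Nat

open Classical

set_option maxHeartbeats 1600000 in -- long regime bookkeeping
/-- **The FULL weighted COLUMN sums of `E(klAnisoFamily J′)·S(F̃_k)` at the flow frame `K_n`, in the KL regime, NO depth window, any rate `jw ≥ J′`**
(see the module docstring): `Σ_{X″} ‖(E S)(X″, X′)‖·klScaleWt jw ≤ 81·2^{J′−k}·C_J·M/β` for every `k + 1 ≤ J′ ≤ n`; one constant per `(R, c″)`.
[cite: BenfattoGiulianiMastropietro2006, §2.7 (2.71a), §2.8 (2.77), (2.82)–(2.83)] -/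
theorem overlapWt_colSum_klEng_flow_all (R : RenConsts) (c'' : ℝ) (hc'' : 0 ≤ c'') :
    ∃ CJ : ℝ, 0 < CJ ∧
      ∀ (G : GeoConsts) (P : SplitConsts) (Q : EngConsts) (cc : ℝ), R.WF2 → 0 < cc → cc ≤ EngineV8.klEngC₃6 P R →
      ∀ μ ∈ klWindowC, ∀ U : ℝ, 0 < U → U ≤ min (EngineV8.klEngU₀3 P R cc) (1 / (R.Gfr 3 + 1)) → c'' * U ≤ 1 →
      ∀ β : ℝ, klBetaMin ≤ β → β ≤ Real.exp (cc / U ^ 2) →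
      ∀ (L M : ℕ) [NeZero L] [NeZero M], EngineV8.klEngL₃ β U ≤ L → EngineV8.klEngM₃ β U L ≤ M →
      ∀ n : ℕ, 1 ≤ n → n ≤ nScales β + 1 → IsKLRegime U cc (-(n : ℤ)) → HistP klPredsV17F2 L M G P Q R β U μ 0 n →
        (∀ m, 1 ≤ m → m < n → FlowPieceOscAt L M c'' β U μ m) →
        ∀ k J' : ℕ, k + 1 ≤ J' → J' ≤ n → ∀ jw : ℕ, J' ≤ jw →
        ∀ X' : SpaceTimeIdx L M × SectorLeg (sectorCount k),
          ∑ X'' : SpaceTimeIdx L M × SectorLeg (sectorCount J'),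
            ‖(sectorAnalysisMatrix L M β (klAnisoFamily L M β μ (klFlowFrameU L M β U μ n) klE0 J') *
              sectorSubMatrix L M β (bgmFatMultiplier L M klE0 β (nambuXiCT L μ (klFlowFrameU L M β U μ n)) k)) X'' X'‖ *
              EngineV8.klScaleWt L M β jw {EngineV8.latticeLegPos (2 * (2 * M)) X'', EngineV8.latticeLegPos (2 * (2 * M)) X'} ≤
            81 * (2 : ℝ) ^ (J' - k) * CJ * M / β := by
  obtain ⟨CT, hCT, h⟩ := charSumWt_nbPair_klEng_flow_all R c'' hc''
  refine ⟨CT + 729 * CT ^ 2 / 2, by positivity, ?_⟩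
  intro G P Q cc hR2 hcc hcc6 μ hμ U hU hUle hcU β hβmin hβc L M _ _ hL3 hM3 n hn1 hnN hreg hhist hosc k J' hJ hJn jw hjw X'
  have hβ0 : 0 < β := pos_of_klBetaMin_le hβmin
  have hL0 : (0 : ℝ) < L := Nat.cast_pos.2 (Nat.pos_of_ne_zero (NeZero.ne L))
  have hM0 : (0 : ℝ) < M := Nat.cast_pos.2 (Nat.pos_of_ne_zero (NeZero.ne M))
  set K : TrigPolyC4v := klFlowFrameU L M β U μ n with hKdef
  -- the weighted neighbouring bounds on the window `[k + 1, J′]`, weight scale `J′` (dominated by each level's own rate), NO depth window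
  have hT : ∀ m : ℕ, k + 1 ≤ m → m ≤ J' → ∀ (ω : Fin (sectorCount m)) (a' : Fin (sectorCount (m - 1))),
      ∑ z : TorusSite 1 (2 * M) × TorusSite 2 L,
        (1 + klScale klE0 J' * β / (2 * M) * |(((z.1 0).valMinAbs : ℤ) : ℝ)| + klScale klE0 J' * |(((z.2 0).valMinAbs : ℤ) : ℝ)| +
            klScale klE0 J' * |(((z.2 1).valMinAbs : ℤ) : ℝ)|) *
        ‖∑ q : TorusSite 1 (2 * M) × TorusSite 2 L, (torusChar q.1 z.1 * torusChar q.2 z.2) •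
          (klAnisoFamily L M β μ K klE0 m ω (⟨(q.1 0).val, ZMod.val_lt (q.1 0)⟩, q.2) *
            klAnisoFamily L M β μ K klE0 (m - 1) a' (⟨(q.1 0).val, ZMod.val_lt (q.1 0)⟩, q.2))‖ ≤ CT * M * (L : ℝ) ^ 2 := by
    intro m hkm hmJ ω a'
    obtain ⟨k₁, rfl⟩ : ∃ k₁, m = k₁ + 1 := ⟨m - 1, by omega⟩
    have hbd := h G P Q cc hR2 hcc hcc6 μ hμ U hU hUle hcU β hβmin hβc L M hL3 hM3 n hn1 hnN hreg hhist hosc k₁ (by omega) ω a'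
    refine le_trans (sum_le_sum fun z _ => mul_le_mul_of_nonneg_right ?_ (norm_nonneg _)) hbd
    have hΛle : klScale klE0 J' ≤ klScale klE0 (k₁ + 1) := EngineV8.klScale_le_klScale (by norm_num [klE0]) hmJ
    have h0 : 0 ≤ |(((z.1 0).valMinAbs : ℤ) : ℝ)| := abs_nonneg _
    have h1 : 0 ≤ |(((z.2 0).valMinAbs : ℤ) : ℝ)| := abs_nonneg _
    have h2 : 0 ≤ |(((z.2 1).valMinAbs : ℤ) : ℝ)| := abs_nonneg _
    have hβM : 0 ≤ β / (2 * M) := by positivity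
    have hΛ0 : 0 ≤ klScale klE0 J' := (klth_klScale_pos J').le
    have ht : klScale klE0 J' * β / (2 * M) ≤ klScale klE0 (k₁ + 1) * β / (2 * M) := by
      rw [mul_div_assoc, mul_div_assoc]; exact mul_le_mul_of_nonneg_right hΛle hβM
    gcongr
  -- the windowed column assembly and the constants
  have hT0 : 0 ≤ CT * M * (L : ℝ) ^ 2 := by positivity
  have hcol := overlapWt_colSum_le_of_nbWindow (L := L) (M := M) hβ0 μ K (n₀ := k + 1) hT0 hT le_rfl hJ X'
  have eTJ : CT * M * (L : ℝ) ^ 2 + 729 * ((((2 * M : ℕ) : ℝ) ^ 1 * (L : ℝ) ^ 2)⁻¹ * (CT * M * (L : ℝ) ^ 2) ^ 2) =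
      (CT + 729 * CT ^ 2 / 2) * M * (L : ℝ) ^ 2 := by
    push_cast
    field_simp
  have e81 : ((27 * 2 ^ (J' - k) : ℕ) : ℝ) * (3 * ((CT + 729 * CT ^ 2 / 2) * M * (L : ℝ) ^ 2) / (β * (L : ℝ) ^ 2)) =
      81 * (2 : ℝ) ^ (J' - k) * (CT + 729 * CT ^ 2 / 2) * M / β := by
    push_cast
    field_simp
    ring
  rw [eTJ, e81] at hcol
  -- any weaker rate `jw ≥ J′`
  exact (Finset.sum_le_sum fun X'' _ => mul_le_mul_of_nonneg_left (EngineV8.klScaleWt_le_of_le β hjw _) (norm_nonneg _)).trans hcol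

/-- **The full weighted column sums in the tower's indexing, NO depth window** (fat `d·k − 1`, thin `J′ ≥ d·k`, weight `jw ≥ J′`): the `cc` column constant of the
source-species step's `T⁺` block at a general jump, `cc := 81·2^{J′−(dk−1)}·C_J·M/β` — the window-free twin of `overlapWt_towerBlockCol_klEng_flow_deep`.
[cite: BenfattoGiulianiMastropietro2006, §2.7 (2.71a), §2.8 (2.77), (2.82)–(2.83)] -/
theorem overlapWt_towerBlockCol_klEng_flow_all (d : ℕ) (R : RenConsts) (c'' : ℝ) (hc'' : 0 ≤ c'') :
    ∃ CJ : ℝ, 0 < CJ ∧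
      ∀ (G : GeoConsts) (P : SplitConsts) (Q : EngConsts) (cc : ℝ), R.WF2 → 0 < cc → cc ≤ EngineV8.klEngC₃6 P R →
      ∀ μ ∈ klWindowC, ∀ U : ℝ, 0 < U → U ≤ min (EngineV8.klEngU₀3 P R cc) (1 / (R.Gfr 3 + 1)) → c'' * U ≤ 1 →
      ∀ β : ℝ, klBetaMin ≤ β → β ≤ Real.exp (cc / U ^ 2) →
      ∀ (L M : ℕ) [NeZero L] [NeZero M], EngineV8.klEngL₃ β U ≤ L → EngineV8.klEngM₃ β U L ≤ M →
      ∀ n : ℕ, 1 ≤ n → n ≤ nScales β + 1 → IsKLRegime U cc (-(n : ℤ)) → HistP klPredsV17F2 L M G P Q R β U μ 0 n →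
        (∀ m, 1 ≤ m → m < n → FlowPieceOscAt L M c'' β U μ m) →
        ∀ k : ℕ, 1 ≤ d * k → ∀ J' : ℕ, d * k ≤ J' → J' ≤ n → ∀ jw : ℕ, J' ≤ jw →
        ∀ X' : SpaceTimeIdx L M × SectorLeg (sectorCount (d * k - 1)),
          ∑ X'' : SpaceTimeIdx L M × SectorLeg (sectorCount J'),
            ‖(sectorAnalysisMatrix L M β (klAnisoFamily L M β μ (klFlowFrameU L M β U μ n) klE0 J') *
              sectorSubMatrix L M β (bgmFatMultiplier L M klE0 β (nambuXiCT L μ (klFlowFrameU L M β U μ n)) (d * k - 1))) X'' X'‖ *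
              EngineV8.klScaleWt L M β jw {EngineV8.latticeLegPos (2 * (2 * M)) X'', EngineV8.latticeLegPos (2 * (2 * M)) X'} ≤
            81 * (2 : ℝ) ^ (J' - (d * k - 1)) * CJ * M / β := by
  obtain ⟨CJ, hCJ, h⟩ := overlapWt_colSum_klEng_flow_all R c'' hc''
  refine ⟨CJ, hCJ, ?_⟩
  intro G P Q cc hR2 hcc hcc6 μ hμ U hU hUle hcU β hβmin hβc L M _ _ hL3 hM3 n hn1 hnN hreg hhist hosc k hdk J' hJ' hJn jw hjw X'
  exact h G P Q cc hR2 hcc hcc6 μ hμ U hU hUle hcU β hβmin hβc L M hL3 hM3 n hn1 hnN hreg hhist hosc (d * k - 1) J' (by omega) hJn jw hjw X'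

end Summit.HubbardSuperconductivity.HubbardSuperconductivity.Theorems.TorusFourierL2

end
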